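import Literature.NumberTheory.Automorphic.QuadraticBaseChangeFrobCompatibleProofs
import Literature.NumberTheory.Automorphic.ReciprocityGLnDescentProofs
import Literature.NumberTheory.Automorphic.BaseChangeArchimedean
import Literature.NumberTheory.Automorphic.AutomorphicTwistBJ
import Literature.NumberTheory.GaloisRepresentations.GaloisRepFrobeniusProofs
import Literature.NumberTheory.GaloisRepresentations.RestrictFieldSemisimple
import HarnessLib

/-!
# `Langlands1980_quadraticBaseChange_frobCompatible` at the places over RAMIFIED primes of `π`:
# reduction to Carayol's theorem (Galois-unramified ⇒ automorphic-unramified)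

Topic `Literature/NumberTheory/Automorphic`; third *proofs* file (theorems only — no definition, no
named fact) of the named fact `Langlands1980_quadraticBaseChange_frobCompatible`
(`QuadraticBaseChangeFrobCompatible`), continuing `QuadraticBaseChangeFrobCompatibleProofs`, which
proved the fact (a) at all but finitely many places unconditionally and (b) at every finite
`w ∤ p` of `F` lying over a prime at which `π` is UNRAMIFIED, granted lang.S27
(`exists_galoisRep_of_regularAlgebraic`) and `ArthurClozel1989_strongLifting_allFinite`.  The
remaining content of the fact sits at the finitely many `w ∤ p` above primes `ℓ` RAMIFIED for `π`
at which `ρ|_{Γ_F}` is nevertheless unramified; the printed argument there (fact's docstring: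
Carayol 1986 Thm. (A) in Weil–Deligne form over `ℚ` + Langlands' local lifting of ramified
principal series, Langlands 1980 §2 (i), (A), (F)) needs two inputs absent from the tree.

This file gives a DIFFERENT reduction of that residue, which needs only ONE local input beyond base
change, and only in its weakest, datum-level form — the **ramification clause of Carayol's
local–global compatibility for Hilbert modular Galois representations**:

> (C) for `K` totally real, `π` cuspidal on `GL₂(𝔸_K)` with `π_∞` regular algebraic, `ι : ℚ̄_ℓ ≃ ℂ`
> and `r : Γ_K → GL₂(ℚ̄_ℓ)` continuous irreducible and compatible with `π` at every `v ∤ ℓ`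
> (`IsGaloisCompatibleAt`), at every finite `w ∤ ℓ` at which `r` is unramified, `π` is unramified

(Carayol 1986, Thm. (A), pp. 410–411, with §0.5; for `[K:ℚ]` even at principal-series places
Taylor 1989/1995, recorded as Jarvis 1997 §7 Thm. 7.2, cases (P1)–(P3); recalled as (1) in Skinner
2009 §1).  (C) is NOT in the tree; a proving seat may not vendor it (D-0026, `lint.fact-fanout`), so
it enters the theorems below as the explicit HYPOTHESIS `hCar`, spelled out in full (it is a
published theorem about Hilbert modular forms over arbitrary totally real fields — no base change,
no quadratic field — and not a restatement or slice of the fact being reduced).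

## What is proved here

* `FramedGaloisRep.isUnramifiedAt_of_restrictField_of_under_eq` (Galois side, any rank, any
  Galois `M/F`): if `v` is unramified in `M` and `σ|_{Γ_M}` is unramified at ONE place `w ∣ v`, then
  `σ` is unramified at `v` (`inertia_le_range_absGaloisRestrict` + `res⁻¹(I_𝔓) = I_𝔔`,
  `comap_inertia_comap_absIntegersMap`, + "one prime above `v` suffices",
  `isUnramifiedAt_of_isUnramifiedAtPrime_holds`; the tree's
  `FramedGaloisRep.isUnramifiedAt_of_restrictField` of `ReciprocityGLnDescentProofs` asks for every
  `w ∣ v`).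
* `isGaloisCompatibleAt_halfTwist_of_eventually` (general rank `n`, `K` totally real or CM,
  granted lang.S27): if the semisimple `ρ` is Satake–Frobenius compatible with the cuspidal
  L-algebraic regular `π` almost everywhere in the L-normalisation, then `ρ` is compatible, in the
  C-normalisation `IsGaloisCompatibleAt` (`m = n`), with the regular algebraic twist
  `π' = π ⊗ |det|^{(n-1)/2}` at EVERY `v ∤ ℓ` — the hypothesis of (C) and of lang.S27's siblings.
* **Case A** — `Langlands1980_quadraticBaseChange_frobCompatible_at_of_isUnramifiedIn` (granted (C)
  over `ℚ`, lang.S27 and `ArthurClozel1989_strongLifting_allFinite`): the fact holds at every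
  `w ∤ p` lying over a prime `ℓ` UNRAMIFIED IN `F` — whatever the ramification of `π` at `ℓ`.
  (`ρ|_{Γ_F}` unramified at `w` ⇒ `ρ` unramified at `ℓ` by the Galois lemma ⇒ `π ⊗ |det|^{1/2}`,
  hence `π`, unramified at `ℓ` by (C) for `K = ℚ` ⇒ case (b) of the previous file.)
* **Real quadratic `F`** — `Langlands1980_quadraticBaseChange_frobCompatible_at_of_isTotallyReal`
  (granted (C) over `F`, lang.S27 over `F` and `ArthurClozel1989_strongLifting_archimedean`): the
  fact holds at EVERY `w ∤ p`, provided `ρ|_{Γ_F}` is irreducible (i.e. `π` is not dihedral by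
  `F`; for the regular `π` of the fact this always holds, but the tree cannot yet prove it).
  (`P` has the regular L-algebraic infinity type `T^F`; `ρ|_{Γ_F}` is compatible with
  `P ⊗ |det|^{1/2}` at every unramified place off `p`; (C) over `F` makes `P` unramified at `w`.)

So, granted (C), lang.S27 and Arthur–Clozel's strong lifting, what is left of the fact is: `F`
imaginary quadratic (or `ρ|_{Γ_F}` reducible), `w ∣ ℓ` with `ℓ` RAMIFIED in `F` (and `π` ramified
at `ℓ`).  The seat notes record the plan for that last case (an auxiliary real quadratic field `F₁`
with `F₁ ⊗ ℚ_ℓ ≅ F_w`, (C) over `F₁`, and Arthur–Clozel up and down the biquadratic `F F₁`).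

## References

* H. Carayol, *Sur les représentations ℓ-adiques associées aux formes modulaires de Hilbert*, Ann.
  Sci. ÉNS 19 (1986), §0.3, §0.5, Thm. (A) (pp. 410–411). [CarayolASENS1986]
* F. Jarvis, *On Galois representations associated to Hilbert modular forms*, J. reine angew.
  Math. 491 (1997), §7, Thm. 7.2 and cases (P1)–(P3), (S1)–(S2), (C1)–(C2). [Jarvis1997]
* C. Skinner, *A note on the p-adic Galois representations attached to Hilbert modular forms*,
  Doc. Math. 14 (2009), §1 (1). [Skinner2009]
* R. P. Langlands, *Base Change for GL(2)*, Ann. of Math. Stud. 96 (1980), §2. [LanglandsBaseChange1980]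
* J. Arthur, L. Clozel, *Simple algebras, base change, and the advanced theory of the trace
  formula*, Ann. of Math. Stud. 120 (1989), Ch. 3 Thm. 5.1; Ch. 1 §6–§7. [ArthurClozelAMS120]
* J. Neukirch, *Algebraic Number Theory* (1999), Ch. I §9, (9.4)–(9.6). [NeukirchANT1999]
-/

noncomputable section

open scoped MatrixGroups Matrix NumberField Polynomial Classical
open NumberField IsDedekindDomain Field Polynomial Filter

/-! ## Galois side: unramifiedness descends from ONE place above an unramified `v` -/

namespace Literature.NumberTheory.GaloisRepresentations

section Descent

variable {F M : Type*} [Field F] [NumberField F] [Field M] [NumberField M] [Algebra F M]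
  {A : Type*} [CommRing A] [TopologicalSpace A] [IsTopologicalRing A] {n : ℕ}

/-- **Unramifiedness descends from one place above an unramified `v`.**  Let `M/F` be a finite
Galois extension of number fields, `v` a finite place of `F` unramified in `M`, `w ∣ v` a place of
`M`, and `σ : Γ_F → GL_n(A)` a framed Galois representation whose restriction `σ|_{Γ_M}` is
unramified at `w`.  Then `σ` is unramified at `v`: for a prime `𝔔 ∣ w` of `\bar ℤ_M` and
`𝔓 = ι⁻¹𝔔 ∣ v`, every element of `I_𝔓` is `res δ` (`inertia_le_range_absGaloisRestrict`) with
`δ ∈ res⁻¹(I_𝔓) = I_𝔔` (`comap_inertia_comap_absIntegersMap`), killed by `σ|_{Γ_M}`; and `σ` is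
unramified at `v` as soon as one inertia group above `v` acts trivially
(`isUnramifiedAt_of_isUnramifiedAtPrime_holds`).  Neukirch I §9 (9.4)–(9.6); Serre 1968 I §2.1.
[cite: NeukirchANT1999, Ch. I §9 (9.6)] -/
theorem FramedGaloisRep.isUnramifiedAt_of_restrictField_of_under_eq [IsGalois F M]
    (σ : FramedGaloisRep F A n) {v : HeightOneSpectrum (𝓞 F)}
    (hv : Algebra.IsUnramifiedIn (𝓞 M) v.asIdeal) {w : HeightOneSpectrum (𝓞 M)}
    (hw : w.asIdeal.under (𝓞 F) = v.asIdeal) (h : (σ.restrictField M).IsUnramifiedAt w) :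
    σ.IsUnramifiedAt v := by
  haveI : Algebra.IsAlgebraic F M := Algebra.IsAlgebraic.tower_top (K := ℚ) F
  have he : v.asIdeal.ramificationIdxIn (𝓞 M) = 1 := ramificationIdxIn_eq_one_of_isUnramifiedIn hv
  obtain ⟨𝔔, h𝔔⟩ := w.primesAbove_nonempty
  haveI : 𝔔.IsPrime := h𝔔.1
  have h𝔓 : 𝔔.comap (absIntegersMap F M) ∈ v.primesAbove := comap_absIntegersMap_mem_primesAbove hw h𝔔
  have hP : σ.toGaloisRep.IsUnramifiedAtPrime (𝔔.comap (absIntegersMap F M)) := by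
    intro g hg
    obtain ⟨δ, rfl⟩ := inertia_le_range_absGaloisRestrict F M he h𝔓 hg
    have hδ : δ ∈ 𝔔.inertia (absoluteGaloisGroup M) := by
      rw [← comap_inertia_comap_absIntegersMap F M 𝔔, Subgroup.mem_comap]
      exact hg
    have h1 : (σ.restrictField M) δ = 1 := h 𝔔 h𝔔 δ hδ
    rw [FramedGaloisRep.restrictField_apply] at h1
    change FramedRep.toRepresentation σ (absGaloisRestrict F M δ) = 1
    refine LinearMap.ext fun u => ?_
    simp [h1]
  rw [← FramedGaloisRep.isUnramifiedAt_toGaloisRep_iff]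
  exact GaloisRep.isUnramifiedAt_of_isUnramifiedAtPrime_holds h𝔓 hP

/-- **At a place unramified in the Galois `M/F`, `σ` is unramified iff `σ|_{Γ_M}` is unramified at
a (any) given place above it.** [cite: NeukirchANT1999, Ch. I §9 (9.6)] -/
theorem FramedGaloisRep.isUnramifiedAt_restrictField_iff_of_under_eq [IsGalois F M]
    (σ : FramedGaloisRep F A n) {v : HeightOneSpectrum (𝓞 F)}
    (hv : Algebra.IsUnramifiedIn (𝓞 M) v.asIdeal) {w : HeightOneSpectrum (𝓞 M)}
    (hw : w.asIdeal.under (𝓞 F) = v.asIdeal) :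
    (σ.restrictField M).IsUnramifiedAt w ↔ σ.IsUnramifiedAt v :=
  ⟨σ.isUnramifiedAt_of_restrictField_of_under_eq hv hw, σ.isUnramifiedAt_restrictField hw⟩

end Descent

end Literature.NumberTheory.GaloisRepresentations

namespace Literature.NumberTheory.Automorphic

open Literature.NumberTheory.GaloisRepresentations

/-! ## Compatibility with the regular algebraic half-twist at every unramified place (lang.S27) -/

section HalfTwist

variable {n : ℕ} {K : Type} [Field K] [NumberField K] {hcpt : isCompact_glFiniteIntegralLevel n K}
  {ℓ : ℕ} [Fact ℓ.Prime]

/-- The real number `(n-1)/2` cast to `ℂ`. [folklore] -/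
private theorem cast_half' (n : ℕ) : ((((n : ℝ) - 1) / 2 : ℝ) : ℂ) = ((n : ℂ) - 1) / 2 := by
  push_cast; ring

/-- **The half-twist is regular algebraic**: if `π` has the regular L-algebraic infinity type `T`
and `π'` has infinity type `T.twist ((n-1)/2)`, then `π'` is regular algebraic (Buzzard–Gee 2014,
§5.3). [cite: BuzzardGeeLMS2014, §5.3] -/
theorem isRegularAlgebraic_of_hasInfinityType_twist_half
    {π' : CuspidalAutomorphicRepData n K hcpt} {T : InfinityType K n}
    (hT' : π'.1.HasInfinityType (T.twist ((((n : ℝ) - 1) / 2 : ℝ) : ℂ))) (hTL : T.IsLAlgebraic)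
    (hTR : T.IsRegular) : π'.1.IsRegularAlgebraic := by
  refine ⟨_, hT', ?_, hTR.twist _⟩
  rw [cast_half']
  exact hTL.isCAlgebraic_twist_half

/-- **Untwisting a Satake parameter**: if `π' = π ⊗ |det|^s` (`W_{π'} = |det|^s W_π`, same for `W'`)
has Satake parameter `β` at `v`, then `π` has Satake parameter `q_v^{s} β` at `v` (the tree's
`HasSatakeParamAt.of_map_mulChar_detTwist_of_cpow` for the inverse twist). Borel–Jacquet 1979, 5.7.
[cite: ArthurClozelAMS120, Ch. 3, proof of Thm. 3.1] -/
theorem hasSatakeParamAt_map_cpow_of_twist {χ : HeckeCharacter K} {s : ℂ}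
    (hχ : ∀ x : ideleGroup K, ((χ x : ℂˣ) : ℂ) = (ideleNorm x : ℂ) ^ s)
    {π π' : AutomorphicRepData (AutomorphyDatum.gl n K hcpt)}
    (hW : π'.W = π.W.map (mulChar (detTwist n χ)))
    (hW' : π'.W' = π.W'.map (mulChar (detTwist n χ)))
    {v : HeightOneSpectrum (𝓞 K)} {β : Multiset ℂ} (hβ : π'.HasSatakeParamAt v β) :
    π.HasSatakeParamAt v (β.map (((v.residueCard : ℂ) ^ s) * ·)) := by
  have hV : π.W = π'.W.map (mulChar (detTwist n χ⁻¹)) := by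
    rw [detTwist_inv, hW, map_mulChar_inv_map_mulChar]
  have hV' : π.W' = π'.W'.map (mulChar (detTwist n χ⁻¹)) := by
    rw [detTwist_inv, hW', map_mulChar_inv_map_mulChar]
  have h2 := AutomorphicRepData.HasSatakeParamAt.of_map_mulChar_detTwist_of_cpow
    (inv_apply_of_cpow hχ) hV hV' hβ
  simpa only [neg_neg] using h2

/-- `q^{-s} (q^{s} b) = b` on multisets (`q > 0`). [folklore] -/
private theorem map_cpow_neg_map_cpow {q : ℕ} (hq : 0 < q) (s : ℂ) (β : Multiset ℂ) :
    (β.map (((q : ℂ) ^ s) * ·)).map (((q : ℂ) ^ (-s)) * ·) = β := by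
  rw [Multiset.map_map]
  conv_rhs => rw [← Multiset.map_id β]
  refine Multiset.map_congr rfl fun b _ ↦ ?_
  have hqC : (q : ℂ) ≠ 0 := by exact_mod_cast hq.ne'
  have hne : (q : ℂ) ^ s ≠ 0 := fun h ↦ hqC ((Complex.cpow_eq_zero_iff _ _).mp h).1
  simp only [Function.comp_apply, id]
  rw [← mul_assoc, Complex.cpow_neg, inv_mul_cancel₀ hne, one_mul]

/-- **Compatibility with the half-twist at every unramified place off `ℓ`, C-normalisation**
(granted lang.S27).  Let `K` be totally real or CM, `π` cuspidal on `GL_n(𝔸_K)` (`n ≥ 1`) with a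
regular L-algebraic infinity type `T`, `ρ : Γ_K → GL_n(ℚ̄_ℓ)` continuous SEMISIMPLE and
Satake–Frobenius compatible with `π` almost everywhere in the L-normalisation
(`arithFrobPolyOfSatake ι q 1 α`), and `π' = π ⊗ |det|^{(n-1)/2}` a twist of `π`
(`W_{π'} = |det|^{(n-1)/2} W_π`, same for `W'`).  Then `ρ` is compatible with `π'` at EVERY finite
`v ∤ ℓ` in the C-normalisation of lang.S27 (`IsGaloisCompatibleAt π' ι ρ v`: for every Satake
parameter `β` of `π'` at `v`, `ρ` is unramified at `v` with arithmetic-Frobenius polynomial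
`arithFrobPolyOfSatake ι q_v n β`): `β = q_v^{-(n-1)/2} α` for the Satake parameter `α = q_v^{(n-1)/2} β`
of `π` at `v`, at which `ρ` is compatible with `π` by
`hasFrobCharpolyAt_one_of_eventually_of_exists_galoisRep`, and the two polynomials agree
(`arithFrobPolyOfSatake_map_cpow_neg_half`).  Buzzard–Gee 2014, §5.3 (L- versus C-normalisation).
[cite: BuzzardGeeLMS2014, §2.1 and §5.3] [cite: HarrisLanTaylorThorneRMS2016, Thm. A] -/
theorem isGaloisCompatibleAt_halfTwist_of_eventually [NeZero n]
    (h27 : exists_galoisRep_of_regularAlgebraic) (hK : IsTotallyReal K ∨ IsCMField K)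
    (ι : PadicAlgCl ℓ ≃+* ℂ) (π : CuspidalAutomorphicRepData n K hcpt) {T : InfinityType K n}
    (hT : π.1.HasInfinityType T) (hTL : T.IsLAlgebraic) (hTR : T.IsRegular)
    (ρ : FramedGaloisRep K (PadicAlgCl ℓ) n) (hρss : ρ.toGaloisRep.IsSemisimple)
    (hρ : ∀ᶠ v : HeightOneSpectrum (𝓞 K) in cofinite,
      ∃ α : Multiset ℂ, π.1.HasSatakeParamAt v α ∧ ρ.IsUnramifiedAt v ∧
        ρ.HasFrobCharpolyAt v (arithFrobPolyOfSatake ι v.residueCard 1 α))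
    {χ : HeckeCharacter K}
    (hχ : ∀ x : ideleGroup K, ((χ x : ℂˣ) : ℂ) = (ideleNorm x : ℂ) ^ ((((n : ℝ) - 1) / 2 : ℝ) : ℂ))
    {π' : CuspidalAutomorphicRepData n K hcpt}
    (hW : π'.1.W = π.1.W.map (mulChar (detTwist n χ)))
    (hW' : π'.1.W' = π.1.W'.map (mulChar (detTwist n χ)))
    {v : HeightOneSpectrum (𝓞 K)} (hv : ((ℓ : ℕ) : 𝓞 K) ∉ v.asIdeal) :
    IsGaloisCompatibleAt π'.1 ι ρ v := by
  intro β hβ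
  have hq : 0 < v.residueCard := Nat.zero_lt_of_lt v.one_lt_residueCard
  -- `α = q^{(n-1)/2} β` is the Satake parameter of `π` at `v`
  have hα := hasSatakeParamAt_map_cpow_of_twist hχ hW hW' hβ
  obtain ⟨hur, hch⟩ := hasFrobCharpolyAt_one_of_eventually_of_exists_galoisRep h27 hK ι π hT hTL
    hTR ρ hρss hρ hv hα
  refine ⟨hur, ?_⟩
  rw [← arithFrobPolyOfSatake_map_cpow_neg_half (n := n) ι hq NeZero.one_le,
    map_cpow_neg_map_cpow hq] at hch
  exact hch

/-- **Irreducible variant** of `isGaloisCompatibleAt_halfTwist_of_eventually`.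
[cite: BuzzardGeeLMS2014, §5.3] -/
theorem isGaloisCompatibleAt_halfTwist_of_eventually_of_isIrreducible [NeZero n]
    (h27 : exists_galoisRep_of_regularAlgebraic) (hK : IsTotallyReal K ∨ IsCMField K)
    (ι : PadicAlgCl ℓ ≃+* ℂ) (π : CuspidalAutomorphicRepData n K hcpt) {T : InfinityType K n}
    (hT : π.1.HasInfinityType T) (hTL : T.IsLAlgebraic) (hTR : T.IsRegular)
    (ρ : FramedGaloisRep K (PadicAlgCl ℓ) n) (hirr : ρ.toGaloisRep.IsIrreducible)
    (hρ : ∀ᶠ v : HeightOneSpectrum (𝓞 K) in cofinite,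
      ∃ α : Multiset ℂ, π.1.HasSatakeParamAt v α ∧ ρ.IsUnramifiedAt v ∧
        ρ.HasFrobCharpolyAt v (arithFrobPolyOfSatake ι v.residueCard 1 α))
    {χ : HeckeCharacter K}
    (hχ : ∀ x : ideleGroup K, ((χ x : ℂˣ) : ℂ) = (ideleNorm x : ℂ) ^ ((((n : ℝ) - 1) / 2 : ℝ) : ℂ))
    {π' : CuspidalAutomorphicRepData n K hcpt}
    (hW : π'.1.W = π.1.W.map (mulChar (detTwist n χ)))
    (hW' : π'.1.W' = π.1.W'.map (mulChar (detTwist n χ)))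
    {v : HeightOneSpectrum (𝓞 K)} (hv : ((ℓ : ℕ) : 𝓞 K) ∉ v.asIdeal) :
    IsGaloisCompatibleAt π'.1 ι ρ v := by
  have hρss : ρ.toGaloisRep.IsSemisimple := by
    haveI : ρ.toGaloisRep.toRepresentation.IsIrreducible := hirr
    change ρ.toGaloisRep.toRepresentation.IsSemisimpleRepresentation
    infer_instance
  exact isGaloisCompatibleAt_halfTwist_of_eventually h27 hK ι π hT hTL hTR ρ hρss hρ hχ hW hW' hv

/-- **Untwisting unramifiedness**: `π` is unramified at `v` iff its twist `π ⊗ |det|^s` is.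
[cite: ArthurClozelAMS120, Ch. 3, proof of Thm. 3.1] -/
theorem isUnramifiedAt_iff_of_twist {χ : HeckeCharacter K} {s : ℂ}
    (hχ : ∀ x : ideleGroup K, ((χ x : ℂˣ) : ℂ) = (ideleNorm x : ℂ) ^ s)
    {π π' : AutomorphicRepData (AutomorphyDatum.gl n K hcpt)}
    (hW : π'.W = π.W.map (mulChar (detTwist n χ)))
    (hW' : π'.W' = π.W'.map (mulChar (detTwist n χ))) (v : HeightOneSpectrum (𝓞 K)) :
    π'.IsUnramifiedAt v ↔ π.IsUnramifiedAt v :=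
  ⟨fun ⟨_, hβ⟩ ↦ ⟨_, hasSatakeParamAt_map_cpow_of_twist hχ hW hW' hβ⟩,
    fun ⟨_, hα⟩ ↦ ⟨_, AutomorphicRepData.HasSatakeParamAt.of_map_mulChar_detTwist_of_cpow hχ hW hW' hα⟩⟩

end HalfTwist

/-! ## The fact at the residual places, granted Carayol's ramification clause (C) -/

section Carayol

/- The hypothesis `hCar` below is Carayol's theorem, ramification clause (C) of the module
docstring: Carayol 1986, Thm. (A) (pp. 410–411) with §0.5; Jarvis 1997, §7 Thm. 7.2 with cases
(P1)–(P3) (Taylor) for `[K:ℚ]` even; Skinner 2009, §1 (1).  It is a hypothesis, not a named fact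
of the tree (see the module docstring for why), stated verbatim in the shape of the sibling fact
`galoisRep_GL2_totallyReal_irreducible` of `HilbertModularGaloisRep`. -/
variable
  (hCar : ∀ {K : Type} [Field K] [NumberField K] (hcpt : isCompact_glFiniteIntegralLevel 2 K),
    IsTotallyReal K →
    ∀ (π : CuspidalAutomorphicRepData 2 K hcpt), π.1.IsRegularAlgebraic →
      ∀ (ℓ : ℕ) [Fact ℓ.Prime] (ι : PadicAlgCl ℓ ≃+* ℂ) (r : FramedGaloisRep K (PadicAlgCl ℓ) 2),
        r.toGaloisRep.IsIrreducible →
        (∀ v : HeightOneSpectrum (𝓞 K), ((ℓ : ℕ) : 𝓞 K) ∉ v.asIdeal →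
          IsGaloisCompatibleAt π.1 ι r v) →
        ∀ w : HeightOneSpectrum (𝓞 K), ((ℓ : ℕ) : 𝓞 K) ∉ w.asIdeal →
          r.IsUnramifiedAt w → π.1.IsUnramifiedAt w)

variable {F : Type} [Field F] [NumberField F] {p : ℕ} [Fact p.Prime]
  {hQ : isCompact_glFiniteIntegralLevel 2 ℚ} {hF : isCompact_glFiniteIntegralLevel 2 F}

omit [Fact p.Prime] in
/-- `(p) ∤ w` in `𝓞 F` implies `(p) ∤ w ∩ 𝓞 ℚ`. [folklore] -/
private theorem natCast_not_mem_under' {w : HeightOneSpectrum (𝓞 F)}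
    (hwp : (p : 𝓞 F) ∉ w.asIdeal) : ((p : ℕ) : 𝓞 ℚ) ∉ (w.under (𝓞 ℚ)).asIdeal := by
  intro h
  apply hwp
  have h' : algebraMap (𝓞 ℚ) (𝓞 F) (p : 𝓞 ℚ) ∈ w.asIdeal := Ideal.mem_comap.mp h
  rwa [map_natCast] at h'

include hCar in
/-- **Case A of the residue: the fact at every `w ∤ p` over a prime unramified in `F`** (granted
Carayol's ramification clause (C) over `ℚ`, lang.S27 and `ArthurClozel1989_strongLifting_allFinite`).
With the data of `Langlands1980_quadraticBaseChange_frobCompatible` — `F/ℚ` quadratic, `π` cuspidal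
on `GL₂(𝔸_ℚ)` with a regular L-algebraic infinity type, `ρ : Γ_ℚ → GL₂(ℚ̄_p)` irreducible and
Satake–Frobenius compatible with `π` almost everywhere, `P` a cuspidal weak base-change lift of `π`
to `F`, and `w ∤ p` a finite place of `F` with `ρ|_{Γ_F}` unramified at `w` — suppose the prime
`ℓ = w ∩ ℤ` is UNRAMIFIED in `F`.  Then `P` has a Satake parameter `α` at `w` and the arithmetic
Frobenii of `ρ|_{Γ_F}` at `w` have characteristic polynomial `arithFrobPolyOfSatake ι q_w 1 α`.
Proof: `ρ` is unramified at `ℓ` (`FramedGaloisRep.isUnramifiedAt_of_restrictField_of_under_eq`,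
`F/ℚ` Galois); `ρ` is compatible with the regular algebraic `π' = π ⊗ |det|^{1/2}` at every
unramified prime off `p` (`isGaloisCompatibleAt_halfTwist_of_eventually_of_isIrreducible`); so by
(C) for `K = ℚ`, `π'`, hence `π`, is unramified at `ℓ`, and the previous file's
`Langlands1980_quadraticBaseChange_frobCompatible_at_of_isUnramifiedAt_under` applies.  This covers
ALL `w ∤ p` off the (at most finitely many) primes ramified in `F`, including those over primes
ramified for `π` (where the hypotheses then turn out to be contradictory).
[cite: CarayolASENS1986, Thm. (A) (pp. 410–411) with §0.5]
[cite: LanglandsBaseChange1980, §2 (A), (F) (pp. 19–20)]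
[cite: ArthurClozelAMS120, Ch. 3 Thm. 5.1 with §1 (1.1) and Def. 1.2] -/
theorem Langlands1980_quadraticBaseChange_frobCompatible_at_of_isUnramifiedIn
    (hAC : ArthurClozel1989_strongLifting_allFinite) (h27 : exists_galoisRep_of_regularAlgebraic)
    (hF2 : Module.finrank ℚ F = 2) (ι : PadicAlgCl p ≃+* ℂ)
    (π : CuspidalAutomorphicRepData 2 ℚ hQ) {T : InfinityType ℚ 2} (hT : π.1.HasInfinityType T)
    (hTL : T.IsLAlgebraic) (hTR : T.IsRegular) (ρ : FramedGaloisRep ℚ (PadicAlgCl p) 2)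
    (hirr : ρ.toGaloisRep.IsIrreducible)
    (hρ : ∀ᶠ v : HeightOneSpectrum (𝓞 ℚ) in cofinite,
      ∃ α : Multiset ℂ, π.1.HasSatakeParamAt v α ∧ ρ.IsUnramifiedAt v ∧
        ρ.HasFrobCharpolyAt v (arithFrobPolyOfSatake ι v.residueCard 1 α))
    (P : CuspidalAutomorphicRepData 2 F hF) (hBC : IsWeakBaseChangeLiftAE π.1 P.1)
    (w : HeightOneSpectrum (𝓞 F)) (hwp : (p : 𝓞 F) ∉ w.asIdeal)
    (hℓF : Algebra.IsUnramifiedIn (𝓞 F) (w.under (𝓞 ℚ)).asIdeal)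
    (hunr : (ρ.restrictField F).IsUnramifiedAt w) :
    ∃ α : Multiset ℂ, P.1.HasSatakeParamAt w α ∧ (ρ.restrictField F).IsUnramifiedAt w ∧
      (ρ.restrictField F).HasFrobCharpolyAt w (arithFrobPolyOfSatake ι w.residueCard 1 α) := by
  haveI : Algebra.IsQuadraticExtension ℚ F := ⟨hF2⟩
  haveI : IsGalois ℚ F := inferInstance
  -- `ρ` is unramified at `ℓ = w ∩ ℤ`
  have hρℓ : ρ.IsUnramifiedAt (w.under (𝓞 ℚ)) :=
    ρ.isUnramifiedAt_of_restrictField_of_under_eq hℓF rfl hunr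
  -- the regular algebraic twist `π' = π ⊗ |det|^{1/2}` and its compatibility with `ρ`
  obtain ⟨χ, π', hχ, hW, hW', hT'⟩ := π.exists_twist_hasInfinityType (((2 : ℝ) - 1) / 2) hT
  have hreg' : π'.1.IsRegularAlgebraic :=
    isRegularAlgebraic_of_hasInfinityType_twist_half (n := 2) (by exact_mod_cast hT') hTL hTR
  have hc : ∀ v : HeightOneSpectrum (𝓞 ℚ), ((p : ℕ) : 𝓞 ℚ) ∉ v.asIdeal →
      IsGaloisCompatibleAt π'.1 ι ρ v := fun v hv ↦
    isGaloisCompatibleAt_halfTwist_of_eventually_of_isIrreducible (n := 2) h27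
      (Or.inl inferInstance) ι π hT hTL hTR ρ hirr hρ (by exact_mod_cast hχ) hW hW' hv
  -- Carayol over `ℚ`: `π'`, hence `π`, is unramified at `ℓ`
  have hπ'ℓ : π'.1.IsUnramifiedAt (w.under (𝓞 ℚ)) :=
    hCar hQ inferInstance π' hreg' p ι ρ hirr hc _ (natCast_not_mem_under' hwp) hρℓ
  have hπℓ : π.1.IsUnramifiedAt (w.under (𝓞 ℚ)) := (isUnramifiedAt_iff_of_twist hχ hW hW' _).mp hπ'ℓ
  exact Langlands1980_quadraticBaseChange_frobCompatible_at_of_isUnramifiedAt_under hAC h27 hF2 ι π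
    hT hTL hTR ρ hirr hρ P hBC w hwp hπℓ

include hCar in
/-- **The fact over a REAL quadratic `F`, for `π` non-dihedral by `F`** (granted Carayol's
ramification clause (C) over `F`, lang.S27 and `ArthurClozel1989_strongLifting_archimedean`): with
the data of `Langlands1980_quadraticBaseChange_frobCompatible`, if `F` is totally real and
`ρ|_{Γ_F}` is irreducible, then at EVERY finite `w ∤ p` at which `ρ|_{Γ_F}` is unramified, `P` has a
Satake parameter `α` at `w` and the arithmetic Frobenii of `ρ|_{Γ_F}` at `w` have characteristic
polynomial `arithFrobPolyOfSatake ι q_w 1 α`.  Proof: `P` has the regular L-algebraic infinity type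
`T^F` (`hasInfinityType_baseChange`); `ρ|_{Γ_F}` is Satake–Frobenius compatible with `P` almost
everywhere (`eventually_satakeFrobCompatible_restrictField_of_isWeakBaseChangeLiftAE`), hence — lang.S27
over `F` — compatible with `P ⊗ |det|^{1/2}` at every unramified place off `p`
(`isGaloisCompatibleAt_halfTwist_of_eventually_of_isIrreducible`); by (C) over `F`, `P ⊗ |det|^{1/2}`,
hence `P`, is unramified at `w`; and at an unramified `w` the compatibility is
`hasFrobCharpolyAt_one_of_eventually_of_exists_galoisRep`.  (No strong lifting at the finite places
is needed here.  `ρ|_{Γ_F}` irreducible fails only for `π` dihedral by `F`, impossible for the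
regular `π` of the fact — Ribet 1977 §4 — but not yet provable in the tree; that case and the
imaginary quadratic `F` are the object of the auxiliary-field argument recorded in the seat notes.)
[cite: CarayolASENS1986, Thm. (A) (pp. 410–411) with §0.5] [cite: Jarvis1997, §7 Thm. 7.2]
[cite: ArthurClozelAMS120, Ch. 3 Thm. 5.1 and Ch. 1 §7] [cite: HarrisLanTaylorThorneRMS2016, Thm. A] -/
theorem Langlands1980_quadraticBaseChange_frobCompatible_at_of_isTotallyReal
    (h27 : exists_galoisRep_of_regularAlgebraic) (hArch : ArthurClozel1989_strongLifting_archimedean)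
    (hF2 : Module.finrank ℚ F = 2) (hFR : IsTotallyReal F) (ι : PadicAlgCl p ≃+* ℂ)
    (π : CuspidalAutomorphicRepData 2 ℚ hQ) {T : InfinityType ℚ 2} (hT : π.1.HasInfinityType T)
    (hTL : T.IsLAlgebraic) (hTR : T.IsRegular) (ρ : FramedGaloisRep ℚ (PadicAlgCl p) 2)
    (hirrF : (ρ.restrictField F).toGaloisRep.IsIrreducible)
    (hρ : ∀ᶠ v : HeightOneSpectrum (𝓞 ℚ) in cofinite,
      ∃ α : Multiset ℂ, π.1.HasSatakeParamAt v α ∧ ρ.IsUnramifiedAt v ∧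
        ρ.HasFrobCharpolyAt v (arithFrobPolyOfSatake ι v.residueCard 1 α))
    (P : CuspidalAutomorphicRepData 2 F hF) (hBC : IsWeakBaseChangeLiftAE π.1 P.1)
    (w : HeightOneSpectrum (𝓞 F)) (hwp : (p : 𝓞 F) ∉ w.asIdeal)
    (hunr : (ρ.restrictField F).IsUnramifiedAt w) :
    ∃ α : Multiset ℂ, P.1.HasSatakeParamAt w α ∧ (ρ.restrictField F).IsUnramifiedAt w ∧
      (ρ.restrictField F).HasFrobCharpolyAt w (arithFrobPolyOfSatake ι w.residueCard 1 α) := by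
  haveI : Algebra.IsQuadraticExtension ℚ F := ⟨hF2⟩
  haveI : IsGalois ℚ F := inferInstance
  have hprime : (Module.finrank ℚ F).Prime := hF2 ▸ Nat.prime_two
  haveI : IsCyclic (F ≃ₐ[ℚ] F) :=
    isCyclic_of_prime_card (p := Module.finrank ℚ F) (hp := ⟨hprime⟩) (IsGalois.card_aut_eq_finrank ℚ F)
  -- `P` has the regular L-algebraic infinity type `T^F`
  have hTP : P.1.HasInfinityType (T.baseChange F) :=
    hArch.hasInfinityType_baseChange inferInstance hprime hBC hT
  -- `ρ|_{Γ_F}` is a.e. compatible with `P`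
  have hρF := eventually_satakeFrobCompatible_restrictField_of_isWeakBaseChangeLiftAE ι 1 π.1 P.1 hBC
    ρ hρ
  -- the twist `P' = P ⊗ |det|^{1/2}`, regular algebraic, compatible with `ρ|_{Γ_F}` off `p`
  obtain ⟨χ, P', hχ, hW, hW', hT'⟩ := P.exists_twist_hasInfinityType (((2 : ℝ) - 1) / 2) hTP
  have hreg' : P'.1.IsRegularAlgebraic :=
    isRegularAlgebraic_of_hasInfinityType_twist_half (n := 2) (by exact_mod_cast hT')
      hTL.baseChange hTR.baseChange
  have hc : ∀ v : HeightOneSpectrum (𝓞 F), ((p : ℕ) : 𝓞 F) ∉ v.asIdeal →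
      IsGaloisCompatibleAt P'.1 ι (ρ.restrictField F) v := fun v hv ↦
    isGaloisCompatibleAt_halfTwist_of_eventually_of_isIrreducible (n := 2) h27 (Or.inl hFR) ι P hTP
      hTL.baseChange hTR.baseChange (ρ.restrictField F) hirrF hρF (by exact_mod_cast hχ) hW hW' hv
  -- Carayol over `F`: `P'`, hence `P`, is unramified at `w`
  have hP'w : P'.1.IsUnramifiedAt w := hCar hF hFR P' hreg' p ι (ρ.restrictField F) hirrF hc w hwp hunr
  obtain ⟨α, hα⟩ : P.1.IsUnramifiedAt w := (isUnramifiedAt_iff_of_twist hχ hW hW' w).mp hP'w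
  exact ⟨α, hα, hasFrobCharpolyAt_one_of_eventually_of_exists_galoisRep_of_isIrreducible h27
    (Or.inl hFR) ι P hTP hTL.baseChange hTR.baseChange (ρ.restrictField F) hirrF hρF hwp hα⟩

end Carayol

end Literature.NumberTheory.Automorphic

end
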